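import Summits.AtomisticToContinuum.Crystallization.Theorems.FreeSplittingCertificatesRadiusLadderFarkas

/-!
# `FiniteRangeSplitting` (stmt-AtomisticToContinuum-12559): class balance and the certificate interface

Second half of `FreeSplittingCertificatesRadiusLadderFarkas` (block-2b unit `b2b-freesplit-A`, gen 5).
VALUE = theorems about the SHAPE of an LP refutation of a rung and the FORMAT of a kernel-checkable certificate —
NOT summit progress; nothing here closes an item.

* TRANSPORT READING `eInf_le_halfSum_of_balanced` / `…_of_invBalanced` : a class-balanced weighted zoo
  (`A_k = A_{conj k}` for every class, resp. up to inversion) forces `(Σ y) · e_∞ ≤ Σ_r y_r h_r`, `h_r` the half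
  pair-sum of row `r` (RESULTS-R2 §6 P6/P7 iii: the refuting object at `R ≥ 1.15` is a class-balanced weighting
  of over-bound rows, since no single deep site exists there);
* `Key.MidSym` (`inv (conj k) = k`: the pattern is symmetric about the bond midpoint) and
  `eInf_le_halfSum_of_midSym` : midpoint-symmetric zoos are inversion-balanced for free (`inv = conj` on
  `keys ∪ conj keys`); an `example` re-derives the tree's star forcing `eInf_le_half_sum_of_symmetric`
  from the Farkas machinery (one row, unit weight) — a kernel-checked consistency check on `bkey` / `load`;
* CERTIFICATE INTERFACE `gload` / `threshold_le_farkas_grouped` / `not_rungAt_of_farkas_grouped` : the weak-duality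
  bound for any GROUPING of bonds finer than the classes (`π : bonds → G`, keys `κ` with `bkey b = κ (π b)`,
  pairing `σ` with `κ (σ g) = conj (κ g)`); a finer grouping only weakens the bound
  (`max(a₁+a₂, b₁+b₂) ≤ max(a₁,b₁) + max(a₂,b₂)`), and this is what a kernel-checked certificate instantiates with
  tables — no class computation inside Lean, only per-bond key identities.
-/

noncomputable section
namespace Summit.AtomisticToContinuum.Crystallization.Theorems.StrictSplittingRuleBirth

open scoped BigOperators Classical
open Literature.MathematicalPhysics.StatisticalMechanics

/-- Euclidean `3`-space. -/
local notation "E3" => EuclideanSpace ℝ (Fin 3)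

namespace Key

/-- Midpoint symmetry of a key `(v, T)`: the pattern is invariant under `u ↦ v - u`, i.e. `inv (conj k) = k`.
[folklore] -/
def MidSym (k : Key) : Prop := k.conj.inv = k

/-- A midpoint-symmetric key has `inv k = conj k`. -/
theorem MidSym.inv_eq {k : Key} (h : k.MidSym) : k.inv = k.conj := by
  have h' := congrArg Key.inv h
  rw [Key.inv_inv] at h'
  exact h'.symm

/-- Midpoint symmetry passes to the conjugate key. -/
theorem MidSym.conj {k : Key} (h : k.MidSym) : k.conj.MidSym := by
  show k.conj.conj.inv = k.conj
  rw [Key.conj_conj]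
  exact h.inv_eq

end Key

section Zoo

variable {ι : Type*} [Fintype ι] {N : ι → ℕ}

/-! ## Class balance: the transport reading (RESULTS-R2 §6 P6/P7 iii) -/

/-- **A class-balanced weighted zoo forces `e_∞ ≤` its average half pair-sum**: if `A_k = A_{conj k}` for every
class (every charged pattern is seen equally from both ends), a rung at `(δ, R)` gives
`(Σ y) · e_∞ ≤ ½ Σ_r y_r Σ_j V(r_ij)`.  This is the exact shape of a non-star refutation (P6): dual mass on
over-bound rows, balanced class by class. -/
theorem eInf_le_halfSum_of_balanced {δ R : ℝ} (hrung : RungAt δ R) (x : ∀ r : ι, Fin (N r) → E3)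
    (hx : ∀ r, Sep δ (x r)) (i : ∀ r : ι, Fin (N r)) {y : ι → ℝ} (hy : ∀ r, 0 ≤ y r) (S : Finset Key)
    (hS : ∀ k ∈ S, k.conj ∈ S) (hS0 : ∀ k ∈ S, k.1 ≠ 0) (hkeys : ∀ b ∈ bonds i, bkey R x i b ∈ S)
    (hbal : ∀ k ∈ S, load R x i y k.conj = load R x i y k) :
    (∑ r, y r) * eInf ≤ (∑ r, y r * ∑ j ∈ Finset.univ.erase (i r), lennardJones (dist (x r (i r)) (x r j))) / 2 := by
  have h := eInf_le_farkas hrung x hx i hy S hS hS0 hkeys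
  have hmax : ∑ k ∈ S, max (load R x i y k) (load R x i y k.conj) = ∑ k ∈ S, load R x i y k :=
    Finset.sum_congr rfl fun k hk => by rw [hbal k hk, max_self]
  rwa [hmax, sum_load_eq R x i y S hkeys] at h

/-- **Inversion-balanced form**: `A_k + A_{inv k} = A_{conj k} + A_{inv (conj k)}` for every class suffices
(inversion averaging is free).  Star forcing `eInf_le_half_sum_of_symmetric` is the one-row case: a
midpoint-symmetric pattern has `inv (conj k) = k`, so with `S = keys ∪ conj keys` every class is
inversion-balanced trivially. -/
theorem eInf_le_halfSum_of_invBalanced {δ R : ℝ} (hrung : RungAt δ R) (x : ∀ r : ι, Fin (N r) → E3)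
    (hx : ∀ r, Sep δ (x r)) (i : ∀ r : ι, Fin (N r)) {y : ι → ℝ} (hy : ∀ r, 0 ≤ y r) (S : Finset Key)
    (hS : ∀ k ∈ S, k.conj ∈ S) (hSi : ∀ k ∈ S, k.inv ∈ S) (hS0 : ∀ k ∈ S, k.1 ≠ 0)
    (hkeys : ∀ b ∈ bonds i, bkey R x i b ∈ S)
    (hbal : ∀ k ∈ S, load R x i y k.conj + load R x i y k.conj.inv = load R x i y k + load R x i y k.inv) :
    (∑ r, y r) * eInf ≤ (∑ r, y r * ∑ j ∈ Finset.univ.erase (i r), lennardJones (dist (x r (i r)) (x r j))) / 2 := by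
  have h := eInf_le_farkas_inv hrung x hx i hy S hS hSi hS0 hkeys
  have hmax : ∑ k ∈ S, max (load R x i y k + load R x i y k.inv)
      (load R x i y k.conj + load R x i y k.conj.inv) = ∑ k ∈ S, (load R x i y k + load R x i y k.inv) :=
    Finset.sum_congr rfl fun k hk => by rw [hbal k hk, max_self]
  have hre : ∑ k ∈ S, load R x i y k.inv = ∑ k ∈ S, load R x i y k :=
    Finset.sum_equiv Key.invPerm (fun k => mem_iff_inv_mem hSi k) (fun k _ => rfl)
  rw [hmax, Finset.sum_add_distrib, hre, sum_load_eq R x i y S hkeys] at h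
  linarith

/-- **Midpoint-symmetric zoos are inversion-balanced for free**: if every bond pattern is midpoint-symmetric
(`inv (conj k) = k`), take `S = keys ∪ conj keys`; then `inv = conj` on `S` and the balance hypothesis of
`eInf_le_halfSum_of_invBalanced` is an identity.  This is star forcing for weighted families of stars. -/
theorem eInf_le_halfSum_of_midSym {δ R : ℝ} (hδ : 0 < δ) (hrung : RungAt δ R) (x : ∀ r : ι, Fin (N r) → E3)
    (hx : ∀ r, Sep δ (x r)) (i : ∀ r : ι, Fin (N r)) {y : ι → ℝ} (hy : ∀ r, 0 ≤ y r)
    (hsym : ∀ b ∈ bonds i, (bkey R x i b).MidSym) :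
    (∑ r, y r) * eInf ≤ (∑ r, y r * ∑ j ∈ Finset.univ.erase (i r), lennardJones (dist (x r (i r)) (x r j))) / 2 := by
  classical
  set K : Finset Key := (bonds i).image (bkey R x i) with hKdef
  have hK0 : ∀ k ∈ K, k.MidSym ∧ k.1 ≠ 0 := by
    intro k hk
    obtain ⟨b, hb, rfl⟩ := Finset.mem_image.mp hk
    refine ⟨hsym b hb, ?_⟩
    obtain ⟨r, j⟩ := b
    have hji : j ≠ i r := by
      simp only [bonds, Finset.mem_sigma, Finset.mem_univ, Finset.mem_erase, true_and, and_true] at hb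
      exact hb
    intro h0
    have hd := hx r j (i r) hji
    simp only [bkey] at h0
    rw [dist_eq_norm, h0, norm_zero] at hd
    linarith
  refine eInf_le_halfSum_of_invBalanced hrung x hx i hy (K ∪ K.image Key.conj) ?_ ?_ ?_ ?_ ?_
  · intro k hk
    rcases Finset.mem_union.mp hk with hk | hk
    · exact Finset.mem_union_right _ (Finset.mem_image_of_mem _ hk)
    · obtain ⟨k', hk', rfl⟩ := Finset.mem_image.mp hk
      rw [Key.conj_conj]
      exact Finset.mem_union_left _ hk'
  · intro k hk
    rcases Finset.mem_union.mp hk with hk | hk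
    · rw [(hK0 k hk).1.inv_eq]
      exact Finset.mem_union_right _ (Finset.mem_image_of_mem _ hk)
    · obtain ⟨k', hk', rfl⟩ := Finset.mem_image.mp hk
      rw [(hK0 k' hk').1]
      exact Finset.mem_union_left _ hk'
  · intro k hk
    rcases Finset.mem_union.mp hk with hk | hk
    · exact (hK0 k hk).2
    · obtain ⟨k', hk', rfl⟩ := Finset.mem_image.mp hk
      simp only [Key.conj, ne_eq, neg_eq_zero]
      exact (hK0 k' hk').2
  · intro b hb
    exact Finset.mem_union_left _ (Finset.mem_image_of_mem _ hb)
  · intro k hk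
    have hm : k.MidSym := by
      rcases Finset.mem_union.mp hk with hk | hk
      · exact (hK0 k hk).1
      · obtain ⟨k', hk', rfl⟩ := Finset.mem_image.mp hk
        exact (hK0 k' hk').1.conj
    have h1 : k.conj.inv = k := hm
    rw [h1, hm.inv_eq, add_comm]

/- **Star forcing re-derived** from the certificate machinery (one row, unit weight): the statement of the
tree's `eInf_le_half_sum_of_symmetric`, obtained here from `eInf_le_farkas_inv` via `eInf_le_halfSum_of_midSym`
— a kernel-checked consistency check on `bkey` / `load` (an `example`, so no duplicate declaration lands). -/
example {δ R : ℝ} (hδ : 0 < δ) (hrung : RungAt δ R) {N₀ : ℕ}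
    (x : Fin N₀ → E3) (hx : Sep δ x) (i : Fin N₀)
    (hsym : ∀ j, j ≠ i → (bondPattern R x i j).image (fun u => (x j - x i) - u) = bondPattern R x i j) :
    eInf ≤ (∑ j ∈ Finset.univ.erase i, lennardJones (dist (x i) (x j))) / 2 := by
  have h := eInf_le_halfSum_of_midSym (ι := Unit) (N := fun _ => N₀) hδ hrung (fun _ => x) (fun _ => hx)
    (fun _ => i) (y := fun _ => (1 : ℝ)) (fun _ => zero_le_one) ?_
  · simpa using h
  · rintro ⟨u, j⟩ hb
    have hji : j ≠ i := by
      simp only [bonds, Finset.mem_sigma, Finset.mem_univ, Finset.mem_erase, true_and, and_true] at hb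
      exact hb
    show Key.inv (Key.conj _) = _
    simp only [bkey, Key.conj, Key.inv, neg_neg, Finset.image_image, Prod.mk.injEq, true_and]
    have hT := hsym j hji
    conv_rhs => rw [← hT]
    congr 1
    funext w
    simp only [Function.comp_apply, neg_sub]

/-! ## Certificate interface: grouped classes

A kernel-checkable certificate need not compute the classes: it lists GROUPS `g : G` of bonds with a common key
`κ g` (a partition finer than the true classes is allowed — the bound only weakens) and a pairing `σ` of groups
with `κ (σ g) = conj (κ g)`; the loads are then plain sums over the listed bonds. -/

/-- The load of a group of bonds. [folklore] -/
def gload {G : Type*} (x : ∀ r : ι, Fin (N r) → E3) (i : ∀ r : ι, Fin (N r)) (y : ι → ℝ)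
    (π : (Σ r : ι, Fin (N r)) → G) (g : G) : ℝ :=
  ∑ b ∈ bonds i, if π b = g then bcoef x i y b else 0

/-- **Weak duality, grouped form**: with groups `π : bonds → G`, keys `κ : G → Key` (`bkey b = κ (π b)`) and a
pairing `σ` (`κ (σ g) = conj (κ g)`), every rule with weighted rows `≥ t` satisfies
`(Σ y) · t ≤ ½ Σ_g max(A_g, A_{σ g})`. -/
theorem threshold_le_farkas_grouped {R t : ℝ} {Φ : E3 → Finset E3 → ℝ} (hΦ : IsRule Φ)
    (x : ∀ r : ι, Fin (N r) → E3) (i : ∀ r : ι, Fin (N r)) (ht : ∀ r, t ≤ siteE R Φ (x r) (i r))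
    {y : ι → ℝ} (hy : ∀ r, 0 ≤ y r) {G : Type*} [Fintype G] (π : (Σ r : ι, Fin (N r)) → G) (κ : G → Key)
    (σ : Equiv.Perm G) (hκ : ∀ b ∈ bonds i, bkey R x i b = κ (π b)) (hσ : ∀ g, κ (σ g) = (κ g).conj)
    (hκ0 : ∀ g, (κ g).1 ≠ 0) :
    (∑ r, y r) * t ≤ (∑ g, max (gload x i y π g) (gload x i y π (σ g))) / 2 := by
  have h1 : (∑ r, y r) * t ≤ ∑ r, y r * siteE R Φ (x r) (i r) := by
    rw [Finset.sum_mul]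
    exact Finset.sum_le_sum fun r _ => mul_le_mul_of_nonneg_left (ht r) (hy r)
  -- regroup the weighted rows by groups
  have h2 : ∑ r, y r * siteE R Φ (x r) (i r) = ∑ g, Φ (κ g).1 (κ g).2 * gload x i y π g := by
    have e1 : ∑ r, y r * siteE R Φ (x r) (i r) =
        ∑ b ∈ bonds i, Φ (bkey R x i b).1 (bkey R x i b).2 * bcoef x i y b := by
      unfold bonds
      rw [Finset.sum_sigma]
      refine Finset.sum_congr rfl fun r _ => ?_
      rw [perturbative_siteE_eq, Finset.mul_sum]
      refine Finset.sum_congr rfl fun j _ => ?_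
      simp only [bkey, bcoef]
      ring
    have e2 : ∀ b ∈ bonds i, Φ (bkey R x i b).1 (bkey R x i b).2 * bcoef x i y b =
        ∑ g, Φ (κ g).1 (κ g).2 * (if π b = g then bcoef x i y b else 0) := by
      intro b hb
      have : ∀ g ∈ (Finset.univ : Finset G), Φ (κ g).1 (κ g).2 * (if π b = g then bcoef x i y b else 0) =
          if π b = g then Φ (κ g).1 (κ g).2 * bcoef x i y b else 0 := by
        intro g _
        split_ifs <;> simp
      rw [Finset.sum_congr rfl this, Finset.sum_ite_eq, hκ b hb]
      simp
    rw [e1, Finset.sum_congr rfl e2, Finset.sum_comm]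
    refine Finset.sum_congr rfl fun g _ => ?_
    rw [gload, Finset.mul_sum]
  -- pair the groups by σ
  have hre : ∑ g, Φ (κ (σ g)).1 (κ (σ g)).2 * gload x i y π (σ g) = ∑ g, Φ (κ g).1 (κ g).2 * gload x i y π g :=
    Equiv.sum_comp σ (fun g => Φ (κ g).1 (κ g).2 * gload x i y π g)
  have hle : ∑ g, (Φ (κ g).1 (κ g).2 * gload x i y π g + Φ (κ (σ g)).1 (κ (σ g)).2 * gload x i y π (σ g)) ≤
      ∑ g, max (gload x i y π g) (gload x i y π (σ g)) := by
    refine Finset.sum_le_sum fun g _ => ?_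
    have hc : Φ (κ g).1 (κ g).2 + Φ (κ g).conj.1 (κ g).conj.2 = 1 := hΦ.2 _ _ (hκ0 g)
    rw [hσ g, show Φ (κ g).conj.1 (κ g).conj.2 = 1 - Φ (κ g).1 (κ g).2 by linarith]
    exact convex_le_max (hΦ.1 _ _).1 (hΦ.1 _ _).2
  rw [Finset.sum_add_distrib, hre] at hle
  rw [h2] at h1
  linarith

/-- **Grouped LP refutation certificate**: `½ Σ_g max(A_g, A_{σ g}) < (Σ y) · B` refutes `RungAt δ R`. -/
theorem not_rungAt_of_farkas_grouped {δ R : ℝ} (x : ∀ r : ι, Fin (N r) → E3) (hx : ∀ r, Sep δ (x r))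
    (i : ∀ r : ι, Fin (N r)) {y : ι → ℝ} (hy : ∀ r, 0 ≤ y r) {G : Type*} [Fintype G]
    (π : (Σ r : ι, Fin (N r)) → G) (κ : G → Key) (σ : Equiv.Perm G)
    (hκ : ∀ b ∈ bonds i, bkey R x i b = κ (π b)) (hσ : ∀ g, κ (σ g) = (κ g).conj) (hκ0 : ∀ g, (κ g).1 ≠ 0)
    (hcert : (∑ g, max (gload x i y π g) (gload x i y π (σ g))) / 2 < (∑ r, y r) * twoConeB) :
    ¬ RungAt δ R := by
  rintro ⟨Φ, hr, hf⟩
  have h := threshold_le_farkas_grouped hr x i (fun r => hf (N r) (x r) (hx r) (i r)) hy π κ σ hκ hσ hκ0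
  have hB : (∑ r, y r) * twoConeB ≤ (∑ r, y r) * eInf :=
    mul_le_mul_of_nonneg_left twoConeB_le_eInf (Finset.sum_nonneg fun r _ => hy r)
  linarith

end Zoo

end Summit.AtomisticToContinuum.Crystallization.Theorems.StrictSplittingRuleBirth

end
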